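/-
Speedrun cell sr-mbsolver / programme hubbard-alg — LIT team (lit-1 gen-13), LEAD ruling r156 (g1) object LD1′: lane-B / L3-D6
transport for `relax = mps(N, D, A)` rows of the SPIN-ROTATED fermion form `jw-srot` (FORMAT-ltisdp §4.11 `hubbard_jwsrot_U<U>`,
SOUNDNESS-ltisdp S8 (b): Jordan–Wigner local dimension `4`, the ONE charge `n_tot` with `q_eff(s) = b·n_tot(s) − a` at filling
`ν = a/b`), PRIMAL form. Sibling of `Transport/MPSPrimalHubbardChain.lean` (lit-1 gen-8, standard form `hubbard_jw`).
HONEST FRAMING: first certified bounds; not a superconductivity verdict; every number certified or labelled float.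

WHAT THIS GIVES. For a `relax = mps(N, D, A)` row of the `jw-srot` form the two readers certify FORMAT §2 (d): `c·y ≥ E` for every
`y = (ρ₃, ω₄, …, ω_N)` feasible for the problem. `ksdnSrotClaim_of_mpsSrotClaim` proves the EDGE "mps-srot-claim ⇒ lti-srot(N)-claim":
that finite statement — `ρ₃` on the three-site window `{-1, 0, 1}` (PSD, trace, LTI `tr_{-1} ρ₃ = tr_{1} ρ₃`, TOTAL-OCCUPATION sectors,
total density of site `-1`, real, `|·| ≤ 1`), the `ω`-rows E4L/E4R/E_mL/E_mR/PSD/sectors/real/bounds with `W₂ = cgMap A 2`, `L = leftMap A`,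
`R = rightMap A` and the sector tags `cgTag q_eff qb` of the charge `q_eff(s) = cb·|occ(s)| − ca ∈ ℤ`, and the `jw-srot` bond objective
`U n_{-1↑}n_{-1↓} − t Σ_σ (c†_{-1σ} c_{0σ̄} + c†_{0σ̄} c_{-1σ})` — IMPLIES the `jw-srot` window statement on `{-1, …, n+1}`, i.e. exactly the
hypothesis `hclaim` of `Transport.ksdnClaim_of_srotClaim` (`Transport/ChainWindowSpinRotationRows.lean`), which in turn gives the standard
`lti(N)` statement and hence the thermodynamic limit (`lti_primal_chainWindow_energyDensity[At]_ge_ksdn`). By name: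
`Rows.MPSChainKSDNNodeSrot.ltiChainKSDNNode` (`Rows/HubbardChainMPSNodesSrot.lean`).

PROOF = the proof of `ksdnClaim_of_mpsClaim` verbatim with the additive charge `q_eff(s) = cb·|occ(s)| − ca` (group `ℤ`) in place of
`(2n↑−1, 2n↓−1)` (group `ℤ²`): (i) coordinates `Fin (n+3) ≃ {-1,…,n+1}` and the relabelled window variable `ρ^F` (PSD, trace one,
`N`-sectored hence `q_eff`-sectored, real, LTI in the `Fin` sense); (ii) the model-independent core `exists_mpsRows_of_window`
(`Transport/MPSPrimalWindow.lean`, KSDN §4.2: `ω_m = C_{m−2}(ρ^F|_{first m})`); (iii) the three-site marginal `ρ₃` and its rows (sectors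
are inherited by marginals for ANY additive site charge, `spinPartialTrace_apply_eq_zero_of_charge`; density and bond objective move along
the inclusion of the initial segment, `trace_toSpin_mul_spinPartialTrace_incl`); (iv) apply the claim.
[cite: KullEtAl2024, §2.3–2.5, §4.2 eqs. (MPSextension), (relaxLocTIn); §6.2] [cite: ArakiMoriya2003, §4.1] [cite: EvansKawahigashi1998, §6.5]
-/
import Summits.Ventures.CertifiedManyBodySolver.Transport.MPSPrimalHubbardChain
import HarnessLib

noncomputable section

open Matrix Complex Filter Topology
open scoped ComplexOrder Kronecker BigOperators
open Literature.Probability.LatticeModels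
open Literature.MathematicalPhysics.QuantumLattice
open Literature.MathematicalPhysics.QuantumLattice.HubbardWave0
open Literature.MathematicalPhysics.QuantumLattice.ThermodynamicLimit
open Literature.MathematicalPhysics.QuantumLattice.JordanWigner
open Literature.MathematicalPhysics.QuantumManyBody.StateRelaxation
open Literature.MathematicalPhysics.QuantumLattice.MPSCoarseGraining
open Literature.Computability.QuantumComplexity (traceLeft traceRight)

namespace Summit.Ventures.CertifiedManyBodySolver.Transport

/-! ### The total occupation as an additive charge: FORMAT-ltisdp's `q_eff = cb·n_tot − ca` of the `jw-srot` form -/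

section Charge

variable {X : Type*} [Fintype X]

/-- If an operator vanishes between configurations with different TOTAL occupation `Σ_x |occ(s_x)|` (the `N`-sector zeros of the
`jw-srot` node), then it vanishes between configurations with different total charge `Σ_x q_eff(s_x)`, `q_eff(s) = cb·|occ(s)| − ca ∈ ℤ`
(FORMAT-ltisdp §4.11 `jw-srot`: "charges = [(n_tot)], cov_mult = (b,), cov_off = (a,)"). [cite: KullEtAl2024, §3.3] -/
theorem apply_eq_zero_of_sum_srotCharge_ne {M : Matrix (TensorIndex X 4) (TensorIndex X 4) ℂ} (cb ca : ℤ)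
    (hsec : ∀ k k' : TensorIndex X 4, (∑ x, (siteOcc (k x)).card) ≠ (∑ x, (siteOcc (k' x)).card) → M k k' = 0)
    (u v : TensorIndex X 4)
    (huv : (∑ x, (fun s : Fin 4 => cb * ((siteOcc s).card : ℤ) - ca) (u x)) ≠
      (∑ x, (fun s : Fin 4 => cb * ((siteOcc s).card : ℤ) - ca) (v x))) : M u v = 0 := by
  by_contra hne
  apply huv
  have h : (∑ x, (siteOcc (u x)).card) = (∑ x, (siteOcc (v x)).card) := by
    by_contra h
    exact hne (hsec u v h)
  have h' : (∑ x, ((siteOcc (u x)).card : ℤ)) = ∑ x, ((siteOcc (v x)).card : ℤ) := by exact_mod_cast h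
  simp only [Finset.sum_sub_distrib, ← Finset.mul_sum, h']

end Charge

/-! ### THEOREM B, `jw-srot` form: the `mps(N, D, A)` statement implies the `jw-srot` window statement -/

section Transport

variable {β : Type*} [Fintype β] [DecidableEq β]

/-- **THEOREM B, `jw-srot` form (edge form): the primal `mps(N, D, A)` statement for `hubbard_jwsrot(U)` implies the primal
`jw-srot` `lti(N)` window statement.** Data: window `N = n+3 ≥ 4` sites; a REAL MPS tensor `A = (A^s)_{s ∈ Fin 4}` on the bond index
type `β`, CHARGE COVARIANT for `q_eff(s) = cb·|occ(s)| − ca` with bond charges `qb : β → ℤ` (FORMAT §4.11/§4.12 "CHECKED at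
generation"); a-priori bounds `B_m ≥ 0` with `‖T^{m−2}‖_F² ≤ B_m²`; the coordinates `e₃ : Fin 3 ≃ {-1,0,1}`, `i ↦ i − 1`. HYPOTHESIS
`hclaim` = the by-value node of a `hubbard_jwsrot` `mps` row: over `ρ₃ : Op (PolySite {-1,0,1}) 4` and `ω₄, …, ω_N` — `ρ₃ ⪰ 0`,
`tr ρ₃ = 1`, LTI `tr_{-1} ρ₃ = tr_{1} ρ₃`, TOTAL-OCCUPATION sector zeros, total density of site `-1` equal to `ν`, real entries, `|ρ₃| ≤ 1`;
E4L/E4R with `ρ₃` read through `e₃` then as (first two, last) / (first, last two); E_mL/E_mR (`m = k+5 ≤ N`); `ω_m ⪰ 0`,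
`cgTag q_eff qb` sectors, real, `|ω_m| ≤ B_m` (`m = k+4 ≤ N`); conclusion
`E ≤ Re tr(toSpin(U n_{-1↑}n_{-1↓} − t Σ_σ (c†_{-1σ} c_{0σ̄} + c†_{0σ̄} c_{-1σ})) ρ₃)`. CONCLUSION: the hypothesis `hclaim` of
`Transport.ksdnClaim_of_srotClaim` on `{-1, …, n+1}` with density `ν` (the `jw-srot` window statement).
[cite: KullEtAl2024, §2.3–2.5, §4.2, §6.2] [cite: ArakiMoriya2003, §4.1] -/
theorem ksdnSrotClaim_of_mpsSrotClaim (t U : ℝ) (n : ℕ) (hn : 1 ≤ n) (A : Fin 4 → Matrix β β ℂ)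
    (hAreal : ∀ s a b, star (A s a b) = A s a b) (qb : β → ℤ) (cb ca : ℤ)
    (hAcov : ∀ s a b, A s a b ≠ 0 → qb b = qb a + (fun s : Fin 4 => cb * ((siteOcc s).card : ℤ) - ca) s)
    (B : ℕ → ℝ) (hB : ∀ k, k + 4 ≤ n + 3 → 0 ≤ B (k + 4) ∧ frobSq (transferOp A ^ (k + 2)) ≤ B (k + 4) ^ 2)
    (e₃ : Fin 3 ≃ PolySite (chainWindow (-1) 1)) (he₃ : ∀ i, ofLex (e₃ i).1 0 = ((i : ℕ) : ℤ) - 1)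
    {ν E : ℝ}
    (hclaim : ∀ (ρ₃ : Op (PolySite (chainWindow (-1) 1)) 4)
        (ω : ℕ → Matrix (Fin 4 × ((β × β) × Fin 4)) (Fin 4 × ((β × β) × Fin 4)) ℂ),
      ρ₃.PosSemidef → ρ₃.trace = 1 →
      spinPartialTrace ((PolySite.affEmb 1 (unitVec 0) (chainWindow (-1) 0)).trans
          (PolySite.incl affShiftSet_chainWindow_zero_subset_one)) ρ₃ =
        spinPartialTrace (PolySite.incl chainWindow_zero_subset_one) ρ₃ →
      (∀ k k' : TensorIndex (PolySite (chainWindow (-1) 1)) 4,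
        (∑ x, (siteOcc (k x)).card) ≠ (∑ x, (siteOcc (k' x)).card) → ρ₃ k k' = 0) →
      ((toSpin (nAt (-unitVec 0) neg_unitVec_mem_chainWindow_one 0 +
          nAt (-unitVec 0) neg_unitVec_mem_chainWindow_one 1) * ρ₃).trace).re = ν →
      (∀ k k' : TensorIndex (PolySite (chainWindow (-1) 1)) 4, starRingEnd ℂ (ρ₃ k k') = ρ₃ k k') →
      (∀ k k' : TensorIndex (PolySite (chainWindow (-1) 1)) 4, ‖ρ₃ k k'‖ ≤ 1) →
      traceLeft (ω 4) = (cgMap A 2 ⊗ₖ (1 : Matrix (Fin 4) (Fin 4) ℂ)) *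
          (ρ₃.submatrix (Equiv.arrowCongr e₃ (Equiv.refl (Fin 4))) (Equiv.arrowCongr e₃ (Equiv.refl (Fin 4)))).submatrix
            ((Equiv.prodComm _ _).trans (Fin.snocEquiv fun _ => Fin 4))
            ((Equiv.prodComm _ _).trans (Fin.snocEquiv fun _ => Fin 4)) *
        (cgMap A 2 ⊗ₖ (1 : Matrix (Fin 4) (Fin 4) ℂ))ᴴ →
      traceRight ((ω 4).submatrix (Equiv.prodAssoc _ _ _) (Equiv.prodAssoc _ _ _)) =
        ((1 : Matrix (Fin 4) (Fin 4) ℂ) ⊗ₖ cgMap A 2) *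
          (ρ₃.submatrix (Equiv.arrowCongr e₃ (Equiv.refl (Fin 4))) (Equiv.arrowCongr e₃ (Equiv.refl (Fin 4)))).submatrix
            (Fin.consEquiv fun _ => Fin 4) (Fin.consEquiv fun _ => Fin 4) *
        ((1 : Matrix (Fin 4) (Fin 4) ℂ) ⊗ₖ cgMap A 2)ᴴ →
      (∀ k, k + 5 ≤ n + 3 → traceLeft (ω (k + 5)) =
        (leftMap A ⊗ₖ (1 : Matrix (Fin 4) (Fin 4) ℂ)) *
          (ω (k + 4)).submatrix (Equiv.prodAssoc _ _ _) (Equiv.prodAssoc _ _ _) *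
        (leftMap A ⊗ₖ (1 : Matrix (Fin 4) (Fin 4) ℂ))ᴴ) →
      (∀ k, k + 5 ≤ n + 3 → traceRight ((ω (k + 5)).submatrix (Equiv.prodAssoc _ _ _) (Equiv.prodAssoc _ _ _)) =
        ((1 : Matrix (Fin 4) (Fin 4) ℂ) ⊗ₖ rightMap A) * ω (k + 4) *
        ((1 : Matrix (Fin 4) (Fin 4) ℂ) ⊗ₖ rightMap A)ᴴ) →
      (∀ k, k + 4 ≤ n + 3 → (ω (k + 4)).PosSemidef) →
      (∀ k, k + 4 ≤ n + 3 → ∀ i j,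
        cgTag (fun s : Fin 4 => cb * ((siteOcc s).card : ℤ) - ca) qb i ≠
        cgTag (fun s : Fin 4 => cb * ((siteOcc s).card : ℤ) - ca) qb j → ω (k + 4) i j = 0) →
      (∀ k, k + 4 ≤ n + 3 → ∀ i j, starRingEnd ℂ (ω (k + 4) i j) = ω (k + 4) i j) →
      (∀ k, k + 4 ≤ n + 3 → ∀ i j, ‖ω (k + 4) i j‖ ≤ B (k + 4)) →
      E ≤ ((toSpin ((U : ℂ) • (nAt (-unitVec 0) neg_unitVec_mem_chainWindow_one 0 *
            nAt (-unitVec 0) neg_unitVec_mem_chainWindow_one 1) +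
          (-(t : ℂ)) • ∑ σ : Fin 2,
            ((cAt (-unitVec 0) neg_unitVec_mem_chainWindow_one σ)ᴴ *
                cAt 0 zero_mem_chainWindow_one σ.rev +
              (cAt 0 zero_mem_chainWindow_one σ.rev)ᴴ *
                cAt (-unitVec 0) neg_unitVec_mem_chainWindow_one σ)) * ρ₃).trace).re) :
    ∀ ρ : Op (PolySite (chainWindow (-1) ((n : ℤ) + 1))) 4, ρ.PosSemidef → ρ.trace = 1 →
      spinPartialTrace ((PolySite.affEmb 1 (unitVec 0) (chainWindow (-1) (n : ℤ))).trans
          (PolySite.incl (affShiftSet_chainWindow_subset (-1) (n : ℤ)))) ρ =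
        spinPartialTrace (PolySite.incl (chainWindow_mono_right (-1) (by omega : (n : ℤ) ≤ n + 1))) ρ →
      (∀ k k' : TensorIndex (PolySite (chainWindow (-1) ((n : ℤ) + 1))) 4,
        (∑ x, (siteOcc (k x)).card) ≠ (∑ x, (siteOcc (k' x)).card) → ρ k k' = 0) →
      ((toSpin (nAt (-unitVec 0) (neg_unitVec_mem_chainWindow (by omega : (-1 : ℤ) ≤ n + 1)) 0 +
          nAt (-unitVec 0) (neg_unitVec_mem_chainWindow (by omega : (-1 : ℤ) ≤ n + 1)) 1) * ρ).trace).re = ν →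
      (∀ k k' : TensorIndex (PolySite (chainWindow (-1) ((n : ℤ) + 1))) 4, starRingEnd ℂ (ρ k k') = ρ k k') →
      (∀ k k' : TensorIndex (PolySite (chainWindow (-1) ((n : ℤ) + 1))) 4, ‖ρ k k'‖ ≤ 1) →
      E ≤ ((toSpin ((U : ℂ) • (nAt (-unitVec 0) (neg_unitVec_mem_chainWindow (by omega : (-1 : ℤ) ≤ n + 1)) 0 *
            nAt (-unitVec 0) (neg_unitVec_mem_chainWindow (by omega : (-1 : ℤ) ≤ n + 1)) 1) +
          (-(t : ℂ)) • ∑ σ : Fin 2,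
            ((cAt (-unitVec 0) (neg_unitVec_mem_chainWindow (by omega : (-1 : ℤ) ≤ n + 1)) σ)ᴴ *
                cAt 0 (zero_mem_chainWindow (by omega : (0 : ℤ) ≤ n + 1)) σ.rev +
              (cAt 0 (zero_mem_chainWindow (by omega : (0 : ℤ) ≤ n + 1)) σ.rev)ᴴ *
                cAt (-unitVec 0) (neg_unitVec_mem_chainWindow (by omega : (-1 : ℤ) ≤ n + 1)) σ)) * ρ).trace).re := by
  intro ρ hpsd htr hLTI hsec hdens hreal _hbd
  classical
  -- the windows `W₃ = {-1,0,1} ⊆ W = {-1,…,n+1}` and the shifts of the LTI embeddings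
  have hW3 : chainWindow (-1) 1 ⊆ chainWindow (-1) ((n : ℤ) + 1) := chainWindow_mono_right (-1) (by omega)
  have hlow3 : IsLowerSet (Set.range (PolySite.incl hW3)) := isLowerSet_range_incl_chainWindow hW3
  have hφ₀ := shift_incl (chainWindow_mono_right (-1) (by omega : (n : ℤ) ≤ n + 1))
  have hφ₁ : ∀ y, ofLex (((PolySite.affEmb 1 (unitVec 0) (chainWindow (-1) (n : ℤ))).trans
      (PolySite.incl (affShiftSet_chainWindow_subset (-1) (n : ℤ)))) y).1 0 = ofLex y.1 0 + 1 := fun y => by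
    rw [shift_affEmb_trans_incl, chain_unitVec_apply_zero]
  -- (i) coordinates and the relabelled window variable `ρ^F`
  obtain ⟨eN, heN⟩ := exists_finEquiv_chainWindow (n + 3) ((n : ℤ) + 1) (by push_cast; ring)
  obtain ⟨e', he'⟩ := exists_finEquiv_chainWindow (n + 2) (n : ℤ) (by push_cast; ring)
  set ρF : Op (Fin (n + 3)) 4 := spinPartialTrace eN.toEmbedding ρ with hρFdef
  have hFpsd : ρF.PosSemidef := posSemidef_spinPartialTrace _ hpsd
  have hFtr : ρF.trace = 1 := by rw [hρFdef, trace_spinPartialTrace, htr]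
  have hsucc : (Fin.succEmb (n + 2)).trans eN.toEmbedding =
      e'.toEmbedding.trans ((PolySite.affEmb 1 (unitVec 0) (chainWindow (-1) (n : ℤ))).trans
        (PolySite.incl (affShiftSet_chainWindow_subset (-1) (n : ℤ)))) := by
    refine embedding_eq_of_coord_eq fun i => ?_
    rw [Function.Embedding.trans_apply, Function.Embedding.trans_apply, Equiv.coe_toEmbedding, Equiv.coe_toEmbedding, heN,
      hφ₁, he', Fin.coe_succEmb, Fin.val_succ]
    push_cast
    ring
  have hcast : (Fin.castSuccEmb : Fin (n + 2) ↪ Fin (n + 3)).trans eN.toEmbedding =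
      e'.toEmbedding.trans (PolySite.incl (chainWindow_mono_right (-1) (by omega : (n : ℤ) ≤ n + 1))) := by
    refine embedding_eq_of_coord_eq fun i => ?_
    rw [Function.Embedding.trans_apply, Function.Embedding.trans_apply, Equiv.coe_toEmbedding, Equiv.coe_toEmbedding, heN,
      hφ₀, he', Fin.coe_castSuccEmb, Fin.val_castSucc, add_zero]
  have hFLTI : spinPartialTrace (Fin.succEmb (n + 2)) ρF = spinPartialTrace Fin.castSuccEmb ρF := by
    rw [hρFdef, ← spinPartialTrace_trans, ← spinPartialTrace_trans, hsucc, hcast, spinPartialTrace_trans e'.toEmbedding,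
      spinPartialTrace_trans e'.toEmbedding, hLTI]
  have hFsecN : ∀ k k' : TensorIndex (Fin (n + 3)) 4,
      (∑ x, (siteOcc (k x)).card) ≠ (∑ x, (siteOcc (k' x)).card) → ρF k k' = 0 :=
    fun k k' h => spinPartialTrace_apply_eq_zero_of_charge (fun s : Fin 4 => (siteOcc s).card) eN.toEmbedding hsec h
  have hFsec : ∀ u v : TensorIndex (Fin (n + 3)) 4,
      (∑ x, (fun s : Fin 4 => cb * ((siteOcc s).card : ℤ) - ca) (u x)) ≠
        (∑ x, (fun s : Fin 4 => cb * ((siteOcc s).card : ℤ) - ca) (v x)) → ρF u v = 0 :=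
    fun u v huv => apply_eq_zero_of_sum_srotCharge_ne cb ca hFsecN u v huv
  have hFstar : ∀ u v, star (ρF u v) = ρF u v := fun u v => by
    have := conj_spinPartialTrace_apply eN.toEmbedding hreal u v
    rwa [starRingEnd_apply] at this
  -- (ii) the model-independent core: KSDN's `ω_m = C_{m−2}(ρ^F|_{first m})`
  obtain ⟨ω, hE4L, hE4R, hEmL, hEmR, hωpsd, hωsec, hωreal, hωbd⟩ :=
    exists_mpsRows_of_window (n + 1) (by omega) A hAreal _ qb hAcov B hB ρF hFpsd hFtr hFLTI hFsec hFstar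
  -- (iii) the three-site marginal `ρ₃` and its rows
  set ρ₃ : Op (PolySite (chainWindow (-1) 1)) 4 := spinPartialTrace (PolySite.incl hW3) ρ with hρ₃def
  have h3psd : ρ₃.PosSemidef := posSemidef_spinPartialTrace _ hpsd
  have h3tr : ρ₃.trace = 1 := by rw [hρ₃def, trace_spinPartialTrace, htr]
  have h3LTI : spinPartialTrace ((PolySite.affEmb 1 (unitVec 0) (chainWindow (-1) 0)).trans
        (PolySite.incl affShiftSet_chainWindow_zero_subset_one)) ρ₃ =
      spinPartialTrace (PolySite.incl chainWindow_zero_subset_one) ρ₃ := by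
    rw [hρ₃def, ← spinPartialTrace_trans, ← spinPartialTrace_trans]
    refine spinPartialTrace_eq_of_shift hφ₀ hφ₁ hLTI 1 ?_ ?_
    · intro y
      rw [shift_trans (shift_affEmb_trans_incl (unitVec (0 : Fin 1)) affShiftSet_chainWindow_zero_subset_one)
        (shift_incl hW3), chain_unitVec_apply_zero]
      push_cast
      ring
    · intro y
      rw [shift_trans (shift_incl chainWindow_zero_subset_one) (shift_incl hW3), add_zero]
  have h3sec : ∀ k k' : TensorIndex (PolySite (chainWindow (-1) 1)) 4,
      (∑ x, (siteOcc (k x)).card) ≠ (∑ x, (siteOcc (k' x)).card) → ρ₃ k k' = 0 :=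
    fun k k' h => spinPartialTrace_apply_eq_zero_of_charge (fun s : Fin 4 => (siteOcc s).card) (PolySite.incl hW3) hsec h
  have h3dens : ((toSpin (nAt (-unitVec 0) neg_unitVec_mem_chainWindow_one 0 +
      nAt (-unitVec 0) neg_unitVec_mem_chainWindow_one 1) * ρ₃).trace).re = ν := by
    rw [hρ₃def, trace_toSpin_mul_spinPartialTrace_incl hW3 hlow3, fermionEmbed_add, fermionEmbed_incl_nAt,
      fermionEmbed_incl_nAt]
    exact hdens
  have h3real : ∀ k k' : TensorIndex (PolySite (chainWindow (-1) 1)) 4, starRingEnd ℂ (ρ₃ k k') = ρ₃ k k' :=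
    fun k k' => conj_spinPartialTrace_apply (PolySite.incl hW3) hreal k k'
  have h3bd : ∀ k k' : TensorIndex (PolySite (chainWindow (-1) 1)) 4, ‖ρ₃ k k'‖ ≤ 1 :=
    norm_apply_le_one_of_posSemidef h3psd h3tr
  -- `ρ^F|_{first 3}` is `ρ₃` read through `e₃`
  have hemb : (Fin.castLEEmb (show 3 ≤ n + 3 by omega)).trans eN.toEmbedding =
      e₃.toEmbedding.trans (PolySite.incl hW3) := by
    refine embedding_eq_of_coord_eq fun i => ?_
    rw [Function.Embedding.trans_apply, Function.Embedding.trans_apply, Equiv.coe_toEmbedding, Equiv.coe_toEmbedding, heN,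
      Fin.castLEEmb_apply, Fin.val_castLE]
    change _ = ofLex (e₃ i).1 0
    rw [he₃]
  have hlink : headMarginal (show 3 ≤ n + 1 + 2 by omega) ρF =
      ρ₃.submatrix (Equiv.arrowCongr e₃ (Equiv.refl (Fin 4))) (Equiv.arrowCongr e₃ (Equiv.refl (Fin 4))) := by
    rw [headMarginal, hρFdef, ← spinPartialTrace_trans, hemb, spinPartialTrace_trans, spinPartialTrace_equiv]
    ext u v
    rw [reindexOp_apply, Matrix.submatrix_apply]
    rfl
  rw [hlink] at hE4L hE4R
  -- (iv) apply the `mps` claim and move the objective back to the big window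
  have hE := hclaim ρ₃ ω h3psd h3tr h3LTI h3sec h3dens h3real h3bd hE4L hE4R hEmL hEmR hωpsd hωsec hωreal hωbd
  rw [hρ₃def, trace_toSpin_mul_spinPartialTrace_incl hW3 hlow3] at hE
  simp only [fermionEmbed_add, fermionEmbed_smul, fermionEmbed_sum, fermionEmbed_mul, fermionEmbed_conjTranspose,
    fermionEmbed_incl_nAt, fermionEmbed_incl_cAt] at hE
  exact hE

end Transport

end Summit.Ventures.CertifiedManyBodySolver.Transport
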